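import Literature.Barriers.RiemannHypothesis.MollifierLimitationsPropBDiag
import Literature.NumberTheory.Sieve.SelbergSymmetryFormula
import Literature.NumberTheory.Sieve.GoldstonGrahamPintzYildirimLemma3
import Literature.NumberTheory.Sieve.MaynardSieveYm
import Literature.NumberTheory.LFunctions.MertensTail
import HarnessLib

/-!
# Radziwiłł 2012, §7 (Soundararajan's quadratic form), part B: the analytic bounds

Second of the files discharging the named fact
`Literature.Barriers.RiemannHypothesis.Radziwill2012_propB_quadForm`
(`Literature/Barriers/RiemannHypothesis/MollifierLimitationsPropB.lean`); part A
(`MollifierLimitationsPropBDiag.lean`) proved the exact identities of §7 of M. Radziwiłł,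
*Limitations to mollifying ζ(s)* (arXiv:1207.6583). This file supplies the estimates that §7 takes
from classical prime number theory, all PROVED from the tree, with absolute (existential)
constants:

* `sum_divisors_vonMangoldt_div_le`, `sum_primeFactors_log_div_le`, `phiR_mul_vonMangoldt_le`,
  `hAF_le` — the prime-power bookkeeping of Lemmas 11–12 in the form
  `h(k) = ∑_{ℓm=k} φ(ℓ)Λ(m)m ≤ φ(k)(log k + 4 log log N + 12)` (`1 ≤ k ≤ N`), from
  `∑_{d∣k} Λ(d)/d ≤ ∑_{p∣k} log p/(p−1)` and `∑_{p∣k} log p/p ≤ log log N + 3` (Mertens I, upper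
  half, from `Literature/NumberTheory/LFunctions/MertensTail.lean`);
* `exists_abs_Gs_sub_log_le` — `G(N) = ∑_{n≤N} μ²(n)/φ(n) = log(N+1) + O(1)` ("using
  `G ∼ log N`", p. 12), from the tree's proof of Goldston–Graham–Pintz–Yıldırım's Lemma 3
  (Halberstam–Richert, Lemma 5.3) with `γ ≡ 1`, `c_γ = 1`
  (`Literature.NumberTheory.Sieve.GGPY.moebiusSqGSum_asymptotic_holds`);
* `sum_moebius_sq_mul_norm_div_le` — Cauchy–Schwarz `∑ μ²(ℓ)|w(ℓ)|/ℓ ≤ √(G·D)` for Lemma 13;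
* `exists_abs_rho_add_le` — the arithmetic input of Lemma 13:
  `∑_{p ≤ N/ℓ, p∤ℓ} log p/(p−1) = log(N/ℓ) + O(log log N)` for squarefree `ℓ ≤ N`, i.e.
  `|ρ(ℓ) + μ(ℓ)(log N − log ℓ)| ≤ (C + log log N) μ(ℓ)²` (Mertens I both halves: the tree's
  `abs_sum_vonMangoldt_div_sub_log_le` and `sum_log_div_prime_bounds`);
* `exists_main_term_ge` — Lemma 14: `(2/G²)∑_{k≤N} μ²(k) log k/φ(k) ≥ 1 − C/log N` (Abel
  summation against `G(j) = log(j+1) + O(1)`).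

## References

* [Radziwill2012] M. Radziwiłł, *Limitations to mollifying ζ(s)*, arXiv:1207.6583 (2012), §7,
  pp. 12–14 (Lemmas 11–14).
* [Apostol1976] T. M. Apostol, *Introduction to Analytic Number Theory* (1976), Thm 4.9
  (`∑_{n≤x} Λ(n)/n = log x + O(1)`), through `Literature/NumberTheory/Sieve/SelbergSymmetryFormula.lean`.
-/

noncomputable section

open Finset ArithmeticFunction Complex Filter
open scoped ArithmeticFunction.Moebius ArithmeticFunction.zeta ComplexConjugate Topology

namespace Literature.Barriers.RiemannHypothesis

namespace PropB

/-! ### Prime-power toolkit -/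

/-- `∑_{m ≤ X} Λ(m)/m ≤ log X + 6` (`X ≥ 1`), from the tree's explicit Mertens estimate
`|∑_{n ≤ x} Λ(n)/n − log x| ≤ 6`. [cite: Apostol1976, Thm 4.9] -/
theorem sum_vonMangoldt_div_le {X : ℕ} (hX : 1 ≤ X) :
    ∑ m ∈ Icc 1 X, Λ m / m ≤ Real.log X + 6 := by
  have h := Literature.NumberTheory.Sieve.SelbergSymmetry.abs_sum_vonMangoldt_div_sub_log_le
    (x := (X : ℝ)) (by exact_mod_cast hX)
  rw [Nat.floor_natCast] at h
  have hI : Icc 1 X = Ioc 0 X := by ext m; simp only [mem_Icc, mem_Ioc]; omega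
  rw [hI]
  have := (abs_le.1 h).2
  linarith

/-- `∑_{d ∣ k} Λ(d)/d ≤ ∑_{p ∣ k} log p/(p − 1)` (group the prime-power divisors by their prime
and sum the geometric series). [folklore] -/
theorem sum_divisors_vonMangoldt_div_le (k : ℕ) :
    ∑ d ∈ k.divisors, Λ d / d ≤ ∑ p ∈ k.primeFactors, Real.log p / ((p : ℝ) - 1) := by
  induction k using Nat.recOnPrimeCoprime with
  | zero => simp
  | prime_pow p n hp =>
    rw [Nat.sum_divisors_prime_pow hp]
    rcases Nat.eq_zero_or_pos n with rfl | hn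
    · simp
    · rw [Nat.primeFactors_prime_pow hn.ne' hp, Finset.sum_singleton]
      have hp1 : (1 : ℝ) < p := by exact_mod_cast hp.one_lt
      have hp0 : (0 : ℝ) < p := by linarith
      -- `∑_{i ≤ n} Λ(p^i)/p^i = log p ∑_{1 ≤ i ≤ n} p^{-i} ≤ log p/(p-1)`
      have hterm : ∀ i ∈ Finset.range (n + 1), Λ (p ^ i) / ((p ^ i : ℕ) : ℝ) =
          if i = 0 then 0 else Real.log p * ((p : ℝ)⁻¹) ^ i := by
        intro i _
        split_ifs with hi
        · subst hi; simp
        · rw [vonMangoldt_apply_pow hi, vonMangoldt_apply_prime hp]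
          push_cast
          rw [inv_pow, div_eq_mul_inv]
      rw [Finset.sum_congr rfl hterm, Finset.sum_ite, Finset.sum_const_zero, zero_add,
        ← Finset.mul_sum]
      have hgeom : ∑ i ∈ (Finset.range (n + 1)).filter (fun i => ¬i = 0), ((p : ℝ)⁻¹) ^ i ≤
          1 / ((p : ℝ) - 1) := by
        have hq0 : 0 ≤ (p : ℝ)⁻¹ := by positivity
        have hq1 : (p : ℝ)⁻¹ < 1 := inv_lt_one_of_one_lt₀ hp1
        have hfilt : (Finset.range (n + 1)).filter (fun i => ¬i = 0) = Finset.Ico 1 (n + 1) := by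
          ext i; simp [Finset.mem_Ico]; omega
        rw [hfilt]
        have h1 := geom_sum_Ico_le_of_lt_one (m := 1) (n := n + 1) hq0 hq1
        refine h1.trans (le_of_eq ?_)
        rw [pow_one]
        field_simp
      calc Real.log p * ∑ i ∈ (Finset.range (n + 1)).filter (fun i => ¬i = 0), ((p : ℝ)⁻¹) ^ i
          ≤ Real.log p * (1 / ((p : ℝ) - 1)) :=
            mul_le_mul_of_nonneg_left hgeom (Real.log_nonneg hp1.le)
        _ = Real.log p / ((p : ℝ) - 1) := by ring
  | coprime a b ha hb hab iha ihb =>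
    have ha0 : a ≠ 0 := by omega
    have hb0 : b ≠ 0 := by omega
    -- restrict to prime powers, where `Λ` lives
    have hres : ∀ n : ℕ, ∑ d ∈ n.divisors, Λ d / d =
        ∑ d ∈ n.divisors.filter IsPrimePow, Λ d / d := by
      intro n
      rw [Finset.sum_filter]
      refine Finset.sum_congr rfl fun d _ => ?_
      split_ifs with h
      · rfl
      · rw [vonMangoldt_eq_zero_iff.2 h, zero_div]
    rw [hres, Nat.mul_divisors_filter_prime_pow hab, Finset.filter_union,
      Finset.sum_union (Nat.disjoint_divisors_filter_isPrimePow hab), ← hres, ← hres,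
      Nat.Coprime.primeFactors_mul hab,
      Finset.sum_union (Nat.Coprime.disjoint_primeFactors hab)]
    exact add_le_add iha ihb

/-- `log p/(p−1) ≤ 2 log p/p` for `p ≥ 2`. [folklore] -/
theorem log_div_sub_one_le {p : ℕ} (hp : 2 ≤ p) :
    Real.log p / ((p : ℝ) - 1) ≤ 2 * (Real.log p / p) := by
  have hp2 : (2 : ℝ) ≤ p := by exact_mod_cast hp
  have hlog : 0 ≤ Real.log p := Real.log_nonneg (by linarith)
  rw [div_le_iff₀ (by linarith), show 2 * (Real.log p / p) * ((p : ℝ) - 1) =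
    Real.log p * (2 * ((p : ℝ) - 1) / p) by ring]
  apply le_mul_of_one_le_right hlog
  rw [le_div_iff₀ (by linarith)]
  linarith

/-- **`∑_{p ∣ k} log p/p ≤ log log N + 3`** for `1 ≤ k ≤ N`, `N ≥ 3`: the primes `p ≤ log N`
contribute at most `∑_{p ≤ log N} log p/p ≤ log log N + 2` (Mertens I, upper half), the primes
`p > log N` at most `(1/log N) ∑_{p∣k} log p ≤ log k/log N ≤ 1`. [folklore] -/
theorem sum_primeFactors_log_div_le {N k : ℕ} (hN : 3 ≤ N) (hk : 1 ≤ k) (hkN : k ≤ N) :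
    ∑ p ∈ k.primeFactors, Real.log p / p ≤ Real.log (Real.log N) + 3 := by
  set y : ℝ := Real.log N with hy
  have hN3 : (3 : ℝ) ≤ N := by exact_mod_cast hN
  have hy1 : 1 ≤ y := by
    rw [hy, ← Real.log_exp 1]
    apply Real.log_le_log (Real.exp_pos 1)
    have := Real.exp_one_lt_d9
    linarith
  have hy0 : 0 < y := by linarith
  -- split the prime factors at `y`
  rw [← Finset.sum_filter_add_sum_filter_not k.primeFactors (fun p : ℕ => (p : ℝ) ≤ y)]
  have hsmall : ∑ p ∈ k.primeFactors.filter (fun p : ℕ => (p : ℝ) ≤ y), Real.log p / p ≤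
      Real.log y + 2 := by
    have hM := (Literature.NumberTheory.LFunctions.MertensBound.sum_log_div_prime_bounds hy1).2
    refine le_trans ?_ hM
    apply Finset.sum_le_sum_of_subset_of_nonneg
    · intro p hp
      rw [Finset.mem_filter] at hp
      have hpp := Nat.prime_of_mem_primeFactors hp.1
      rw [Nat.mem_primesLE]
      exact ⟨Nat.le_floor hp.2, hpp⟩
    · intro p hp _
      have := (Nat.mem_primesLE.1 hp).2.pos
      positivity
  have hlarge : ∑ p ∈ k.primeFactors.filter (fun p : ℕ => ¬(p : ℝ) ≤ y), Real.log p / p ≤ 1 := by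
    have h1 : ∑ p ∈ k.primeFactors.filter (fun p : ℕ => ¬(p : ℝ) ≤ y), Real.log p / p ≤
        ∑ p ∈ k.primeFactors.filter (fun p : ℕ => ¬(p : ℝ) ≤ y), Real.log p / y := by
      refine Finset.sum_le_sum fun p hp => ?_
      rw [Finset.mem_filter, not_le] at hp
      have hpp := Nat.prime_of_mem_primeFactors hp.1
      have hlogp : 0 ≤ Real.log p := Real.log_nonneg (by exact_mod_cast hpp.one_lt.le)
      exact div_le_div_of_nonneg_left hlogp hy0 hp.2.le
    have h2 : ∑ p ∈ k.primeFactors.filter (fun p : ℕ => ¬(p : ℝ) ≤ y), Real.log p / y ≤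
        (∑ p ∈ k.primeFactors, Real.log p) / y := by
      rw [← Finset.sum_div]
      apply div_le_div_of_nonneg_right _ hy0.le
      apply Finset.sum_le_sum_of_subset_of_nonneg (Finset.filter_subset _ _)
      intro p hp _
      exact Real.log_nonneg (by exact_mod_cast (Nat.prime_of_mem_primeFactors hp).one_lt.le)
    have h3 : (∑ p ∈ k.primeFactors, Real.log p) / y ≤ 1 := by
      rw [div_le_one hy0]
      -- `∑_{p ∣ k} log p = log ∏_{p ∣ k} p ≤ log k ≤ log N` (cf. the tree's
      -- `Literature.NumberTheory.Sieve.sum_primeFactors_log_le`, not imported to keep the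
      -- import closure small)
      have hrad : ∑ p ∈ k.primeFactors, Real.log p ≤ Real.log k := by
        rw [← Real.log_prod (fun p hp => by
          exact_mod_cast (Nat.prime_of_mem_primeFactors hp).ne_zero)]
        apply Real.log_le_log
        · exact Finset.prod_pos fun p hp => by
            exact_mod_cast (Nat.prime_of_mem_primeFactors hp).pos
        · rw [← Nat.cast_prod]
          exact_mod_cast Nat.le_of_dvd (by omega) (Nat.prod_primeFactors_dvd k)
      refine hrad.trans ?_
      exact Real.log_le_log (by exact_mod_cast hk) (by exact_mod_cast hkN)
    linarith
  linarith

/-- `Λ(d)/φ(d) ≤ 2 Λ(d)/d` (`φ(p^j) = p^{j−1}(p−1) ≥ p^j/2`). [folklore] -/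
theorem vonMangoldt_div_totient_le (d : ℕ) : Λ d / (d.totient : ℝ) ≤ 2 * (Λ d / d) := by
  by_cases h : IsPrimePow d
  · obtain ⟨p, j, hp, hj, rfl⟩ := h
    have hp' := hp.nat_prime
    have hp2 : (2 : ℝ) ≤ p := by exact_mod_cast hp'.two_le
    rw [Nat.totient_prime_pow hp' hj]
    have hΛ : 0 ≤ Λ (p ^ j) := vonMangoldt_nonneg
    have hpow : ((p ^ j : ℕ) : ℝ) = (p : ℝ) ^ (j - 1) * p := by
      rw [Nat.cast_pow, ← pow_succ, Nat.sub_add_cancel hj]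
    have hφ : ((p ^ (j - 1) * (p - 1) : ℕ) : ℝ) = (p : ℝ) ^ (j - 1) * ((p : ℝ) - 1) := by
      rw [Nat.cast_mul, Nat.cast_pow, Nat.cast_sub hp'.one_lt.le, Nat.cast_one]
    rw [hpow, hφ]
    have hpj : 0 < (p : ℝ) ^ (j - 1) := by positivity
    rw [div_le_iff₀ (by apply mul_pos hpj; linarith)]
    calc Λ (p ^ j) = 2 * (Λ (p ^ j) / ((p : ℝ) ^ (j - 1) * p)) * ((p : ℝ) ^ (j - 1) * (p / 2)) := by
          field_simp
      _ ≤ 2 * (Λ (p ^ j) / ((p : ℝ) ^ (j - 1) * p)) * ((p : ℝ) ^ (j - 1) * ((p : ℝ) - 1)) := by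
          apply mul_le_mul_of_nonneg_left _ (by positivity)
          apply mul_le_mul_of_nonneg_left _ hpj.le
          linarith
  · rw [vonMangoldt_eq_zero_iff.2 h]; simp

/-- **`(φ ⋆ Λ)(k) ≤ 4 φ(k) (log log N + 3)`** for `1 ≤ k ≤ N`, `N ≥ 3`: by
`φ(k/d)φ(d) ≤ φ(k)`, `(φ⋆Λ)(k) ≤ φ(k) ∑_{d∣k} Λ(d)/φ(d) ≤ 2φ(k) ∑_{d∣k} Λ(d)/d ≤
2φ(k)∑_{p∣k} log p/(p−1) ≤ 4φ(k) ∑_{p∣k} log p/p`. (The source: "`φ(ℓ)/ℓ = φ(m)/m (1 + O(1/p))`",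
error `O(φ(m)/m² log log m)`.) [cite: Radziwill2012, proof of Lemma 12] -/
theorem phiR_mul_vonMangoldt_le {N k : ℕ} (hN : 3 ≤ N) (hk : 1 ≤ k) (hkN : k ≤ N) :
    (phiR * Λ) k ≤ 4 * (k.totient : ℝ) * (Real.log (Real.log N) + 3) := by
  rw [ArithmeticFunction.mul_apply, Nat.sum_divisorsAntidiagonal' (fun i j => phiR i * Λ j)]
  -- `φ(k/d) Λ(d) ≤ φ(k) Λ(d)/φ(d)`
  have h1 : ∀ d ∈ k.divisors, phiR (k / d) * Λ d ≤ (k.totient : ℝ) * (Λ d / (d.totient : ℝ)) := by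
    intro d hd
    have hdk := Nat.dvd_of_mem_divisors hd
    have hd0 : d ≠ 0 := (Nat.mem_divisors.1 hd).2 |> fun h => by rintro rfl; simp at hdk; omega
    have hφd : (0 : ℝ) < d.totient := by exact_mod_cast Nat.totient_pos.2 (Nat.pos_of_ne_zero hd0)
    rw [phiR_apply, mul_div_assoc', le_div_iff₀ hφd]
    have hsm : ((k / d).totient : ℝ) * (d.totient : ℝ) ≤ (k.totient : ℝ) := by
      have := Nat.totient_super_multiplicative (k / d) d
      rw [Nat.div_mul_cancel hdk] at this
      exact_mod_cast this
    calc ((k / d).totient : ℝ) * Λ d * (d.totient : ℝ) = ((k / d).totient : ℝ) * (d.totient : ℝ) * Λ d := by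
          ring
      _ ≤ (k.totient : ℝ) * Λ d := mul_le_mul_of_nonneg_right hsm vonMangoldt_nonneg
  refine (Finset.sum_le_sum h1).trans ?_
  rw [← Finset.mul_sum]
  have h2 : ∑ d ∈ k.divisors, Λ d / (d.totient : ℝ) ≤ 2 * ∑ d ∈ k.divisors, Λ d / d := by
    rw [Finset.mul_sum]
    exact Finset.sum_le_sum fun d _ => vonMangoldt_div_totient_le d
  have h3 := sum_divisors_vonMangoldt_div_le k
  have h4 : ∑ p ∈ k.primeFactors, Real.log p / ((p : ℝ) - 1) ≤
      2 * ∑ p ∈ k.primeFactors, Real.log p / p := by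
    rw [Finset.mul_sum]
    exact Finset.sum_le_sum fun p hp => log_div_sub_one_le (Nat.prime_of_mem_primeFactors hp).two_le
  have h5 := sum_primeFactors_log_div_le hN hk hkN
  have hφ : (0 : ℝ) ≤ k.totient := by positivity
  calc (k.totient : ℝ) * ∑ d ∈ k.divisors, Λ d / (d.totient : ℝ)
      ≤ (k.totient : ℝ) * (2 * (2 * (Real.log (Real.log N) + 3))) := by
        apply mul_le_mul_of_nonneg_left _ hφ
        linarith
    _ = 4 * (k.totient : ℝ) * (Real.log (Real.log N) + 3) := by ring

/-- **`h(k) ≤ φ(k)(log k + 4 log log N + 12)`** for `1 ≤ k ≤ N`, `N ≥ 3`.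
[cite: Radziwill2012, proof of Lemma 12] -/
theorem hAF_le {N k : ℕ} (hN : 3 ≤ N) (hk : 1 ≤ k) (hkN : k ≤ N) :
    hAF k ≤ (k.totient : ℝ) * (Real.log k + 4 * (Real.log (Real.log N) + 3)) := by
  rw [hAF, ArithmeticFunction.add_apply, Dlog_apply, phiR_apply]
  have := phiR_mul_vonMangoldt_le hN hk hkN
  nlinarith

/-! ### `G = ∑_{n ≤ N} μ²(n)/φ(n) = log N + O(1)` (Halberstam–Richert / GGPY Lemma 3 with `γ ≡ 1`) -/

open Literature.NumberTheory.Sieve in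
/-- **`G(N) = log(N+1) + O(1)`**: `|∑_{n≤N} μ²(n)/φ(n) − log(N+1)| ≤ C` for all `N ≥ 1`, from the
tree's proof of Goldston–Graham–Pintz–Yıldırım's Lemma 3 (Halberstam–Richert Lemma 5.3) applied to
`γ ≡ 1` (`g = 1/φ` on squarefrees, `c_γ = 1`). The source uses "`G ∼ log N`".
[cite: Radziwill2012, §7 ("using G ∼ log N")] -/
theorem exists_abs_Gs_sub_log_le : ∃ C : ℝ, 0 ≤ C ∧ ∀ N : ℕ, 1 ≤ N → |Gs N - Real.log ((N : ℝ) + 1)| ≤ C := by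
  obtain ⟨C, hC⟩ := GGPY.moebiusSqGSum_asymptotic_holds 2 10 (by norm_num) (by norm_num)
  have h1 := hypOmega1_gammaInd 1
  have h2 := hypOmega2_gammaInd (P := 1) one_ne_zero
  rw [Nat.primeFactors_one, Finset.sum_empty, add_zero] at h2
  obtain ⟨_, hz⟩ := hC 6 (by norm_num) (gammaInd 1) h1 h2
  have hcg : GGPY.cGamma (gammaInd 1) = 1 := by
    rw [cGamma_gammaInd one_ne_zero]; simp
  have hGsum : ∀ N : ℕ, GGPY.moebiusSqGSum (gammaInd 1) ((N : ℝ) + 1) = Gs N := by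
    intro N
    unfold GGPY.moebiusSqGSum Gs
    have hceil : ⌈(N : ℝ) + 1⌉₊ = N + 1 := by
      rw [show (N : ℝ) + 1 = ((N + 1 : ℕ) : ℝ) by push_cast; ring, Nat.ceil_natCast]
    have hI : Finset.Ico 1 (N + 1) = Icc 1 N := by
      ext d; simp only [Finset.mem_Ico, mem_Icc]; omega
    rw [hceil, hI]
    refine Finset.sum_congr rfl fun d hd => ?_
    have hd0 : d ≠ 0 := by have := (mem_Icc.1 hd).1; omega
    rw [moebius_sq_mul_g_gammaInd hd0]
    by_cases hsq : Squarefree d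
    · rw [if_pos ⟨hsq, Nat.coprime_one_right d⟩]
      have : ((μ d : ℝ)) ^ 2 = 1 := by
        rw [← Int.cast_pow, moebius_sq_eq_one_of_squarefree hsq]; simp
      rw [this]
    · rw [if_neg (fun h => hsq h.1), moebius_eq_zero_of_not_squarefree hsq]; simp
  have hC0 : 0 ≤ C * 6 := by
    have h := hz 2 le_rfl
    rw [hcg] at h
    have := (abs_nonneg _).trans h
    linarith
  refine ⟨C * 6, hC0, fun N hN => ?_⟩
  have hz' := hz ((N : ℝ) + 1) (by
    have : (1 : ℝ) ≤ N := by exact_mod_cast hN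
    linarith)
  rw [hcg, one_mul, mul_one, hGsum] at hz'
  exact hz'

/-- Consequences: `log N − C ≤ G ≤ log N + 1 + C` and `1 ≤ G` for `N ≥ 1`. [folklore] -/
theorem Gs_bounds {C : ℝ} (hC : ∀ N : ℕ, 1 ≤ N → |Gs N - Real.log ((N : ℝ) + 1)| ≤ C) {N : ℕ}
    (hN : 1 ≤ N) : Real.log N - C ≤ Gs N ∧ Gs N ≤ Real.log N + 1 + C := by
  have h := abs_le.1 (hC N hN)
  have hN1 : (1 : ℝ) ≤ N := by exact_mod_cast hN
  have hlog1 : Real.log N ≤ Real.log ((N : ℝ) + 1) := Real.log_le_log (by linarith) (by linarith)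
  have hlog2 : Real.log ((N : ℝ) + 1) ≤ Real.log N + 1 := by
    have : Real.log ((N : ℝ) + 1) ≤ Real.log (2 * N) := Real.log_le_log (by linarith) (by linarith)
    rw [Real.log_mul two_ne_zero (by linarith)] at this
    have := Real.log_two_lt_d9
    linarith
  constructor <;> linarith [h.1, h.2]

/-- `1 ≤ G` (`N ≥ 1`). [folklore] -/
theorem one_le_Gs {N : ℕ} (hN : 1 ≤ N) : 1 ≤ Gs N := by
  unfold Gs
  have h1 : (1 : ℕ) ∈ Icc 1 N := by simp [hN]
  rw [← Finset.add_sum_erase _ _ h1]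
  have : ((μ 1 : ℝ)) ^ 2 / ((1 : ℕ).totient : ℝ) = 1 := by simp
  rw [this]
  have : 0 ≤ ∑ n ∈ (Icc 1 N).erase 1, ((μ n : ℝ)) ^ 2 / (n.totient : ℝ) :=
    Finset.sum_nonneg fun n _ => by positivity
  linarith

/-! ### Cauchy–Schwarz for the cross terms -/

/-- `∑_ℓ μ(ℓ)² |w(ℓ)|/ℓ ≤ √(G·D)` (Cauchy–Schwarz with `μ²/φ` and `φ|w|²/ℓ²`).
[cite: Radziwill2012, Lemma 13] -/
theorem sum_moebius_sq_mul_norm_div_le {N : ℕ} (a : ℕ → ℂ) (hN : 1 ≤ N) :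
    ∑ ℓ ∈ Icc 1 N, ((μ ℓ : ℝ)) ^ 2 * ‖wv N a ℓ‖ / ℓ ≤ Real.sqrt (Gs N * Dv N a) := by
  set f : ℕ → ℝ := fun ℓ => |(μ ℓ : ℝ)| / Real.sqrt (ℓ.totient : ℝ) with hf
  set g : ℕ → ℝ := fun ℓ => |(μ ℓ : ℝ)| * Real.sqrt (ℓ.totient : ℝ) * ‖wv N a ℓ‖ / ℓ with hg
  have hfg : ∀ ℓ ∈ Icc 1 N, ((μ ℓ : ℝ)) ^ 2 * ‖wv N a ℓ‖ / ℓ = f ℓ * g ℓ := by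
    intro ℓ hℓ
    have hℓ1 : 1 ≤ ℓ := (mem_Icc.1 hℓ).1
    have hφ : (0 : ℝ) < ℓ.totient := by exact_mod_cast Nat.totient_pos.2 hℓ1
    have hs : Real.sqrt (ℓ.totient : ℝ) ≠ 0 := (Real.sqrt_pos.2 hφ).ne'
    simp only [hf, hg]
    rw [← sq_abs ((μ ℓ : ℝ))]
    field_simp
  have hS : 0 ≤ ∑ ℓ ∈ Icc 1 N, ((μ ℓ : ℝ)) ^ 2 * ‖wv N a ℓ‖ / ℓ :=
    Finset.sum_nonneg fun ℓ _ => by positivity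
  rw [← Real.sqrt_sq hS, Finset.sum_congr rfl hfg]
  apply Real.sqrt_le_sqrt
  refine (Finset.sum_mul_sq_le_sq_mul_sq _ f g).trans ?_
  have hf2 : ∑ ℓ ∈ Icc 1 N, f ℓ ^ 2 = Gs N := by
    unfold Gs
    refine Finset.sum_congr rfl fun ℓ hℓ => ?_
    have hℓ1 : 1 ≤ ℓ := (mem_Icc.1 hℓ).1
    have hφ : (0 : ℝ) ≤ ℓ.totient := by positivity
    simp only [hf]
    rw [div_pow, Real.sq_sqrt hφ, sq_abs]
  have hg2 : ∑ ℓ ∈ Icc 1 N, g ℓ ^ 2 ≤ Dv N a := by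
    unfold Dv
    refine Finset.sum_le_sum fun ℓ hℓ => ?_
    have hℓ1 : 1 ≤ ℓ := (mem_Icc.1 hℓ).1
    have hφ : (0 : ℝ) ≤ ℓ.totient := by positivity
    have hμ : |(μ ℓ : ℝ)| ≤ 1 := by exact_mod_cast abs_moebius_le_one
    simp only [hg]
    rw [div_pow, mul_pow, mul_pow, Real.sq_sqrt hφ, sq_abs]
    have hμ2 : ((μ ℓ : ℝ)) ^ 2 ≤ 1 := by
      rw [← sq_abs]; nlinarith [abs_nonneg ((μ ℓ : ℝ))]
    have h0 : 0 ≤ (ℓ.totient : ℝ) * ‖wv N a ℓ‖ ^ 2 / (ℓ : ℝ) ^ 2 := by positivity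
    calc ((μ ℓ : ℝ)) ^ 2 * (ℓ.totient : ℝ) * ‖wv N a ℓ‖ ^ 2 / (ℓ : ℝ) ^ 2
        = ((μ ℓ : ℝ)) ^ 2 * ((ℓ.totient : ℝ) * ‖wv N a ℓ‖ ^ 2 / (ℓ : ℝ) ^ 2) := by ring
      _ ≤ 1 * ((ℓ.totient : ℝ) * ‖wv N a ℓ‖ ^ 2 / (ℓ : ℝ) ^ 2) := mul_le_mul_of_nonneg_right hμ2 h0
      _ = (ℓ.totient : ℝ) / (ℓ : ℝ) ^ 2 * ‖wv N a ℓ‖ ^ 2 := by ring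
  rw [hf2]
  exact mul_le_mul_of_nonneg_left hg2 (by linarith [one_le_Gs hN])

/-! ### `∑ Λ(m)/m²` is bounded -/

/-- `∑_{m ≤ X} Λ(m)/m² ≤ C` for an absolute `C` (`Λ(m) ≤ log m ≤ 2√m` and `∑ m^{-3/2} < ∞`).
[folklore] -/
theorem exists_sum_vonMangoldt_div_sq_le : ∃ C : ℝ, 0 ≤ C ∧ ∀ X : ℕ, ∑ m ∈ Icc 1 X, Λ m / (m : ℝ) ^ 2 ≤ C := by
  have hsum : Summable (fun n : ℕ => ((n : ℝ) ^ (3 / 2 : ℝ))⁻¹) :=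
    Real.summable_nat_rpow_inv.2 (by norm_num)
  set S := ∑' n : ℕ, ((n : ℝ) ^ (3 / 2 : ℝ))⁻¹ with hS
  have hS0 : 0 ≤ S := tsum_nonneg fun n => by positivity
  refine ⟨2 * S, by positivity, fun X => ?_⟩
  have hterm : ∀ m ∈ Icc 1 X, Λ m / (m : ℝ) ^ 2 ≤ 2 * ((m : ℝ) ^ (3 / 2 : ℝ))⁻¹ := by
    intro m hm
    have hm1 : 1 ≤ m := (mem_Icc.1 hm).1
    have hm0 : (0 : ℝ) < m := by exact_mod_cast hm1
    have hlog : Real.log m ≤ (m : ℝ) ^ (1 / 2 : ℝ) / (1 / 2) :=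
      Real.log_le_rpow_div hm0.le (by norm_num)
    have hΛ : Λ m ≤ Real.log m := vonMangoldt_le_log
    have key : (m : ℝ) ^ (1 / 2 : ℝ) / (1 / 2) / (m : ℝ) ^ 2 = 2 * ((m : ℝ) ^ (3 / 2 : ℝ))⁻¹ := by
      have h2 : (m : ℝ) ^ 2 = (m : ℝ) ^ (1 / 2 : ℝ) * (m : ℝ) ^ (3 / 2 : ℝ) := by
        rw [← Real.rpow_add hm0, ← Real.rpow_two]; norm_num
      have h3 : (m : ℝ) ^ (1 / 2 : ℝ) ≠ 0 := (Real.rpow_pos_of_pos hm0 _).ne'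
      have h4 : (m : ℝ) ^ (3 / 2 : ℝ) ≠ 0 := (Real.rpow_pos_of_pos hm0 _).ne'
      rw [h2]
      field_simp
    calc Λ m / (m : ℝ) ^ 2 ≤ (m : ℝ) ^ (1 / 2 : ℝ) / (1 / 2) / (m : ℝ) ^ 2 := by
          apply div_le_div_of_nonneg_right (hΛ.trans hlog) (by positivity)
      _ = 2 * ((m : ℝ) ^ (3 / 2 : ℝ))⁻¹ := key
  calc ∑ m ∈ Icc 1 X, Λ m / (m : ℝ) ^ 2 ≤ ∑ m ∈ Icc 1 X, 2 * ((m : ℝ) ^ (3 / 2 : ℝ))⁻¹ :=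
        Finset.sum_le_sum hterm
    _ = 2 * ∑ m ∈ Icc 1 X, ((m : ℝ) ^ (3 / 2 : ℝ))⁻¹ := by rw [Finset.mul_sum]
    _ ≤ 2 * S := by
        apply mul_le_mul_of_nonneg_left _ (by norm_num)
        exact hsum.sum_le_tsum _ (fun n _ => by positivity)

/-! ### Lemma 13's arithmetic input: `ρ(ℓ) = −μ(ℓ)(log(N/ℓ) + O(log log N))` -/

/-- The summand of `ρ(ℓ)/φ(ℓ)·φ(ℓ)` for squarefree `ℓ`: `φ(ℓ)Λ(m)μ(mℓ)/φ(mℓ) = −μ(ℓ) u(m)` with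
`u(m) = log m/(m−1)` if `m` is a prime not dividing `ℓ` and `0` otherwise. [cite: Radziwill2012, Lemma 13] -/
theorem rho_summand_eq {ℓ : ℕ} (hℓ : Squarefree ℓ) (hℓ0 : ℓ ≠ 0) {m : ℕ} (hm : m ≠ 0) :
    (ℓ.totient : ℝ) * (Λ m * ((μ (m * ℓ) : ℝ) / ((m * ℓ).totient : ℝ))) =
      -(μ ℓ : ℝ) * (if m.Prime ∧ ¬m ∣ ℓ then Real.log m / ((m : ℝ) - 1) else 0) := by
  have hφℓ : (ℓ.totient : ℝ) ≠ 0 := by exact_mod_cast (Nat.totient_pos.2 (Nat.pos_of_ne_zero hℓ0)).ne'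
  split_ifs with h
  · obtain ⟨hp, hnd⟩ := h
    have hcop : m.Coprime ℓ := (Nat.Prime.coprime_iff_not_dvd hp).2 hnd
    rw [isMultiplicative_moebius.map_mul_of_coprime hcop, Nat.totient_mul hcop,
      moebius_apply_prime hp, Nat.totient_prime hp, vonMangoldt_apply_prime hp]
    have hm1 : (1 : ℝ) < m := by exact_mod_cast hp.one_lt
    have hsub : ((m - 1 : ℕ) : ℝ) = (m : ℝ) - 1 := by
      rw [Nat.cast_sub hp.one_lt.le, Nat.cast_one]
    push_cast
    rw [hsub]
    have : (m : ℝ) - 1 ≠ 0 := by linarith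
    field_simp
  · -- `μ(mℓ) Λ(m) = 0`
    rw [not_and_or, not_not] at h
    suffices h0 : Λ m * (μ (m * ℓ) : ℝ) = 0 by
      rw [mul_div_assoc', ← mul_div_assoc, h0]; simp
    by_cases hΛ : Λ m = 0
    · rw [hΛ, zero_mul]
    · have hpp : IsPrimePow m := vonMangoldt_ne_zero_iff.1 hΛ
      rcases h with hnp | hdvd
      · -- prime power, not prime ⇒ not squarefree
        have hnsq : ¬Squarefree m := by
          intro hsq
          obtain ⟨p, k, hp, hk, rfl⟩ := hpp
          have hp' := hp.nat_prime
          rcases Nat.lt_or_ge k 2 with hk2 | hk2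
          · interval_cases k
            exact hnp (by simpa using hp')
          · have : p * p ∣ p ^ k := ⟨p ^ (k - 2), by
              rw [← pow_two, ← pow_add, Nat.add_sub_cancel' hk2]⟩
            exact hp'.ne_one (Nat.isUnit_iff.1 (hsq p this))
        have : ¬Squarefree (m * ℓ) := fun hsq => hnsq (hsq.of_mul_left)
        rw [moebius_eq_zero_of_not_squarefree this]; simp
      · -- `m ∣ ℓ` with `m` a prime power ≥ p: then `p² ∣ mℓ`
        obtain ⟨p, k, hp, hk, rfl⟩ := hpp
        have hp' := hp.nat_prime
        have hpm : p ∣ p ^ k := dvd_pow_self p (by omega)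
        have hpl : p ∣ ℓ := hpm.trans hdvd
        have : ¬Squarefree (p ^ k * ℓ) := by
          intro hsq
          have : p * p ∣ p ^ k * ℓ := mul_dvd_mul hpm hpl
          exact hp'.ne_one (Nat.isUnit_iff.1 (hsq p this))
        rw [moebius_eq_zero_of_not_squarefree this]; simp

/-- `u(m) ≤ Λ(m)/m + 2Λ(m)/m²`. [folklore] -/
theorem rho_u_le (ℓ : ℕ) {m : ℕ} (hm : 1 ≤ m) :
    (if m.Prime ∧ ¬m ∣ ℓ then Real.log m / ((m : ℝ) - 1) else 0) ≤ Λ m / m + 2 * (Λ m / (m : ℝ) ^ 2) := by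
  have hΛ : 0 ≤ Λ m := vonMangoldt_nonneg
  split_ifs with h
  · have hp := h.1
    rw [vonMangoldt_apply_prime hp]
    have hm2 : (2 : ℝ) ≤ m := by exact_mod_cast hp.two_le
    have hlog : 0 ≤ Real.log m := Real.log_nonneg (by linarith)
    have hm0 : (0 : ℝ) < m := by linarith
    have key : (Real.log m / m + 2 * (Real.log m / (m : ℝ) ^ 2)) * ((m : ℝ) - 1) =
        Real.log m * (((m : ℝ) ^ 2 + m - 2) / (m : ℝ) ^ 2) := by
      field_simp; ring
    rw [div_le_iff₀ (by linarith), key]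
    apply le_mul_of_one_le_right hlog
    rw [le_div_iff₀ (by positivity)]
    nlinarith
  · positivity

/-- `u(m) ≥ [m prime] log m/m − [m prime, m ∣ ℓ] log m/m`. [folklore] -/
theorem rho_u_ge (ℓ m : ℕ) :
    (if m.Prime then Real.log m / m else 0) - (if m.Prime ∧ m ∣ ℓ then Real.log m / m else 0) ≤
      (if m.Prime ∧ ¬m ∣ ℓ then Real.log m / ((m : ℝ) - 1) else 0) := by
  by_cases hp : m.Prime
  · have hm2 : (2 : ℝ) ≤ m := by exact_mod_cast hp.two_le
    have hlog : 0 ≤ Real.log m := Real.log_nonneg (by linarith)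
    by_cases hd : m ∣ ℓ
    · rw [if_pos hp, if_pos ⟨hp, hd⟩, if_neg (fun h => h.2 hd)]; simp
    · rw [if_pos hp, if_neg (fun h => hd h.2), if_pos ⟨hp, hd⟩, sub_zero]
      exact div_le_div_of_nonneg_left hlog (by linarith) (by linarith)
  · rw [if_neg hp, if_neg (fun h => hp h.1), if_neg (fun h => hp h.1)]; simp

/-- `∑_{m ≤ X, m prime} log m/m = ∑_{p ∈ primesLE X} log p/p ≥ log X − 4`. [folklore] -/
theorem sum_Icc_filter_prime_log_div_ge {X : ℕ} (hX : 1 ≤ X) :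
    Real.log X - 4 ≤ ∑ m ∈ Icc 1 X, (if m.Prime then Real.log m / m else 0) := by
  have h := (Literature.NumberTheory.LFunctions.MertensBound.sum_log_div_prime_bounds
    (t := (X : ℝ)) (by exact_mod_cast hX)).1
  rw [Nat.floor_natCast] at h
  refine h.trans (le_of_eq ?_)
  rw [← Finset.sum_filter]
  apply Finset.sum_congr _ (fun _ _ => rfl)
  ext p
  rw [Nat.mem_primesLE, Finset.mem_filter, mem_Icc]
  constructor
  · rintro ⟨h1, h2⟩; exact ⟨⟨h2.one_lt.le, h1⟩, h2⟩
  · rintro ⟨⟨_, h1⟩, h2⟩; exact ⟨h1, h2⟩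

/-- `∑_{m ≤ X, m prime, m ∣ ℓ} log m/m ≤ ∑_{p ∣ ℓ} log p/p` (`ℓ ≠ 0`). [folklore] -/
theorem sum_Icc_filter_prime_dvd_le {X ℓ : ℕ} (hℓ : ℓ ≠ 0) :
    ∑ m ∈ Icc 1 X, (if m.Prime ∧ m ∣ ℓ then Real.log m / m else 0) ≤
      ∑ p ∈ ℓ.primeFactors, Real.log p / p := by
  rw [← Finset.sum_filter]
  apply Finset.sum_le_sum_of_subset_of_nonneg
  · intro p hp
    rw [Finset.mem_filter] at hp
    exact Nat.mem_primeFactors.2 ⟨hp.2.1, hp.2.2, hℓ⟩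
  · intro p hp _
    have := (Nat.prime_of_mem_primeFactors hp).pos
    positivity

/-- **The arithmetic input of Lemma 13**: there is an absolute `C` such that for `N ≥ 3` and
`1 ≤ ℓ ≤ N`, `|ρ(ℓ) + μ(ℓ)(log N − log ℓ)| ≤ (C + log log N) μ(ℓ)²` — i.e. for squarefree `ℓ`,
`∑_{p ≤ N/ℓ, p ∤ ℓ} log p/(p − 1) = log(N/ℓ) + O(log log N)` ("`= log N/ℓ + O(log log N)`" in the
source), and `ρ(ℓ) = 0 = μ(ℓ)` otherwise. [cite: Radziwill2012, Lemma 13] -/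
theorem exists_abs_rho_add_le : ∃ C : ℝ, 0 ≤ C ∧ ∀ N : ℕ, 3 ≤ N → ∀ ℓ ∈ Icc 1 N,
    |rho N ℓ + (μ ℓ : ℝ) * (Real.log N - Real.log ℓ)| ≤
      (C + Real.log (Real.log N)) * ((μ ℓ : ℝ)) ^ 2 := by
  obtain ⟨C₂, hC₂0, hC₂⟩ := exists_sum_vonMangoldt_div_sq_le
  refine ⟨2 * C₂ + 10, by positivity, fun N hN ℓ hℓ => ?_⟩
  obtain ⟨hℓ1, hℓN⟩ := mem_Icc.1 hℓ
  have hℓ0 : ℓ ≠ 0 := by omega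
  have hN3 : (3 : ℝ) ≤ N := by exact_mod_cast hN
  have hlogN1 : 1 ≤ Real.log N := by
    rw [← Real.log_exp 1]
    apply Real.log_le_log (Real.exp_pos 1)
    have := Real.exp_one_lt_d9; linarith
  have hloglog : 0 ≤ Real.log (Real.log N) := Real.log_nonneg hlogN1
  by_cases hsq : Squarefree ℓ
  swap
  · -- `ρ(ℓ) = 0`, `μ(ℓ) = 0`
    have hμ : μ ℓ = 0 := moebius_eq_zero_of_not_squarefree hsq
    have hρ : rho N ℓ = 0 := by
      unfold rho
      rw [Finset.sum_eq_zero, mul_zero]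
      intro m _
      have : ¬Squarefree (m * ℓ) := fun h => hsq h.of_mul_right
      rw [moebius_eq_zero_of_not_squarefree this]; simp
    rw [hρ, hμ]; simp
  -- squarefree case
  set X := N / ℓ with hX
  have hX1 : 1 ≤ X := (Nat.le_div_iff_mul_le (by omega)).2 (by simpa using hℓN)
  have hXpos : (0 : ℝ) < X := by exact_mod_cast hX1
  set u : ℕ → ℝ := fun m => if m.Prime ∧ ¬m ∣ ℓ then Real.log m / ((m : ℝ) - 1) else 0 with hu
  have hρ : rho N ℓ = -(μ ℓ : ℝ) * ∑ m ∈ Icc 1 X, u m := by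
    unfold rho
    rw [Finset.mul_sum, Finset.mul_sum]
    refine Finset.sum_congr rfl fun m hm => ?_
    have hm0 : m ≠ 0 := by have := (mem_Icc.1 hm).1; omega
    exact rho_summand_eq hsq hℓ0 hm0
  set P := ∑ m ∈ Icc 1 X, u m with hP
  have hμ1 : ((μ ℓ : ℝ)) ^ 2 = 1 := by
    rw [← Int.cast_pow, moebius_sq_eq_one_of_squarefree hsq]; simp
  have habsμ : |(μ ℓ : ℝ)| = 1 := by
    rw [← Int.cast_abs, abs_moebius_eq_one_of_squarefree hsq]; simp
  -- the target is `|P − (log N − log ℓ)| ≤ C + log log N`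
  have hgoal : |rho N ℓ + (μ ℓ : ℝ) * (Real.log N - Real.log ℓ)| = |P - (Real.log N - Real.log ℓ)| := by
    rw [hρ, show -(μ ℓ : ℝ) * P + (μ ℓ : ℝ) * (Real.log N - Real.log ℓ) =
      -(μ ℓ : ℝ) * (P - (Real.log N - Real.log ℓ)) by ring, abs_mul, abs_neg, habsμ, one_mul]
  rw [hgoal, hμ1, mul_one]
  -- `log X` versus `log N − log ℓ`
  have hℓpos : (0 : ℝ) < ℓ := by exact_mod_cast hℓ1
  have hNpos : (0 : ℝ) < N := by linarith
  have hXle : (X : ℝ) ≤ N / ℓ := Nat.cast_div_le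
  have hXge : (N : ℝ) / ℓ ≤ 2 * X := by
    rw [div_le_iff₀ hℓpos]
    have h := Nat.div_add_mod N ℓ
    have hmod := Nat.mod_lt N (by omega : 0 < ℓ)
    have : (N : ℝ) = ℓ * X + (N % ℓ : ℕ) := by
      rw [hX]; exact_mod_cast h.symm
    rw [this]
    have h1 : ((N % ℓ : ℕ) : ℝ) ≤ ℓ := by exact_mod_cast hmod.le
    have hX1' : (1 : ℝ) ≤ X := by exact_mod_cast hX1
    have h2 : (ℓ : ℝ) ≤ ℓ * X := by nlinarith
    linarith
  have hlogX_le : Real.log X ≤ Real.log N - Real.log ℓ := by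
    rw [← Real.log_div hNpos.ne' hℓpos.ne']
    exact Real.log_le_log hXpos hXle
  have hlogX_ge : Real.log N - Real.log ℓ - 1 ≤ Real.log X := by
    rw [← Real.log_div hNpos.ne' hℓpos.ne']
    have : Real.log ((N : ℝ) / ℓ) ≤ Real.log (2 * X) := Real.log_le_log (by positivity) hXge
    rw [Real.log_mul two_ne_zero hXpos.ne'] at this
    have := Real.log_two_lt_d9
    linarith
  -- upper bound for `P`
  have hPup : P ≤ Real.log X + 6 + 2 * C₂ := by
    have h1 : P ≤ ∑ m ∈ Icc 1 X, (Λ m / m + 2 * (Λ m / (m : ℝ) ^ 2)) :=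
      Finset.sum_le_sum fun m hm => rho_u_le ℓ (mem_Icc.1 hm).1
    rw [Finset.sum_add_distrib, ← Finset.mul_sum] at h1
    have h2 := sum_vonMangoldt_div_le hX1
    have h3 := hC₂ X
    linarith
  -- lower bound for `P`
  have hPlo : Real.log X - 4 - (Real.log (Real.log N) + 3) ≤ P := by
    have h1 : ∑ m ∈ Icc 1 X, ((if m.Prime then Real.log m / m else 0) -
        (if m.Prime ∧ m ∣ ℓ then Real.log m / m else 0)) ≤ P :=
      Finset.sum_le_sum fun m _ => rho_u_ge ℓ m
    rw [Finset.sum_sub_distrib] at h1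
    have h2 := sum_Icc_filter_prime_log_div_ge hX1
    have h3 := sum_Icc_filter_prime_dvd_le (X := X) hℓ0
    have h4 := sum_primeFactors_log_div_le hN hℓ1 hℓN
    linarith
  rw [abs_le]
  constructor <;> linarith

/-! ### Lemma 14: `−2 B(z,z) = (2/G²) ∑_{k≤N} μ²(k) log k/φ(k) ≥ 1 − O(1/log N)` -/

/-- `∑_{i < n} F(i+1) = ∑_{k ∈ Icc 1 n} F(k)`. [folklore] -/
theorem sum_range_succ_eq_sum_Icc {M : Type*} [AddCommMonoid M] (F : ℕ → M) (n : ℕ) :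
    ∑ i ∈ Finset.range n, F (i + 1) = ∑ k ∈ Icc 1 n, F k := by
  rw [Finset.range_eq_Ico, Finset.sum_Ico_add' F 0 n 1]
  exact Finset.sum_congr (by ext k; simp only [Finset.mem_Ico, mem_Icc]; omega) fun _ _ => rfl

/-- Abel summation for `∑_{k ≤ N} g(k) log k`:
`∑_{k≤N} g(k) log k = G(N) log N − ∑_{j=1}^{N−1} (log(j+1) − log j) G(j)`, `G(j) = ∑_{k ≤ j} g(k)`.
[folklore] -/
theorem sum_mul_log_eq_abel (g : ℕ → ℝ) (N : ℕ) (hN : 1 ≤ N) :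
    ∑ k ∈ Icc 1 N, g k * Real.log k =
      (∑ k ∈ Icc 1 N, g k) * Real.log N -
        ∑ j ∈ Finset.Ico 1 N, (Real.log ((j : ℝ) + 1) - Real.log j) * ∑ k ∈ Icc 1 j, g k := by
  have key := Finset.sum_range_by_parts (fun i => Real.log ((i : ℝ) + 1)) (fun i => g (i + 1)) N
  have hI : ∀ n : ℕ, ∑ i ∈ Finset.range n, g (i + 1) = ∑ k ∈ Icc 1 n, g k :=
    fun n => sum_range_succ_eq_sum_Icc g n
  have hL : ∑ i ∈ Finset.range N, Real.log ((i : ℝ) + 1) • g (i + 1) =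
      ∑ k ∈ Icc 1 N, g k * Real.log k := by
    rw [← sum_range_succ_eq_sum_Icc (fun k => g k * Real.log k) N]
    refine Finset.sum_congr rfl fun i _ => ?_
    rw [smul_eq_mul]; push_cast; ring
  rw [hL] at key
  rw [key, hI, smul_eq_mul]
  have hN' : ((N - 1 : ℕ) : ℝ) + 1 = N := by
    rw [Nat.cast_sub hN, Nat.cast_one]; ring
  rw [hN', mul_comm]
  congr 1
  -- the correction sum: reindex `i ↦ j = i + 1`
  have hJ : ∑ i ∈ Finset.range (N - 1), (Real.log (((i + 1 : ℕ) : ℝ) + 1) - Real.log ((i : ℝ) + 1)) •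
      ∑ k ∈ Finset.range (i + 1), g (k + 1) =
      ∑ i ∈ Finset.range (N - 1), (fun j : ℕ => (Real.log ((j : ℝ) + 1) - Real.log j) *
        ∑ k ∈ Icc 1 j, g k) (i + 1) := by
    refine Finset.sum_congr rfl fun i _ => ?_
    rw [smul_eq_mul, hI]
    push_cast
    ring_nf
  rw [hJ]
  refine (sum_range_succ_eq_sum_Icc (fun j : ℕ => (Real.log ((j : ℝ) + 1) - Real.log j) *
    ∑ k ∈ Icc 1 j, g k) (N - 1)).trans ?_
  exact Finset.sum_congr (by ext j; simp only [Finset.mem_Ico, mem_Icc]; omega) fun _ _ => rfl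

/-- `∑_{j=1}^{N−1} Δ_j log(j+1) ≤ (log N)²/2 + 1` with `Δ_j = log(j+1) − log j`: indeed
`Δ_j log(j+1) = ((log(j+1))² − (log j)²)/2 + Δ_j²/2`, the first part telescopes and
`Δ_j ≤ 1/j`, `∑ 1/j² ≤ 2`. [folklore] -/
theorem sum_delta_mul_log_le (N : ℕ) (hN : 1 ≤ N) :
    ∑ j ∈ Finset.Ico 1 N, (Real.log ((j : ℝ) + 1) - Real.log j) * Real.log ((j : ℝ) + 1) ≤
      Real.log N ^ 2 / 2 + 1 := by
  have hid : ∀ j ∈ Finset.Ico 1 N, (Real.log ((j : ℝ) + 1) - Real.log j) * Real.log ((j : ℝ) + 1) =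
      (Real.log ((j : ℝ) + 1) ^ 2 - Real.log j ^ 2) / 2 +
        (Real.log ((j : ℝ) + 1) - Real.log j) ^ 2 / 2 := by
    intro j _; ring
  rw [Finset.sum_congr rfl hid, Finset.sum_add_distrib, ← Finset.sum_div, ← Finset.sum_div]
  -- telescope
  have htel : ∑ j ∈ Finset.Ico 1 N, (Real.log ((j : ℝ) + 1) ^ 2 - Real.log j ^ 2) = Real.log N ^ 2 := by
    have h := Finset.sum_Ico_sub (fun j => Real.log (j : ℝ) ^ 2) hN
    simp only [Nat.cast_add, Nat.cast_one, Real.log_one, zero_pow two_ne_zero, sub_zero] at h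
    exact h
  -- the squares
  have hsq : ∑ j ∈ Finset.Ico 1 N, (Real.log ((j : ℝ) + 1) - Real.log j) ^ 2 ≤ 2 := by
    have h1 : ∀ j ∈ Finset.Ico 1 N, (Real.log ((j : ℝ) + 1) - Real.log j) ^ 2 ≤ ((j : ℝ) ^ 2)⁻¹ := by
      intro j hj
      have hj1 : (1 : ℝ) ≤ j := by exact_mod_cast (Finset.mem_Ico.1 hj).1
      have hjpos : (0 : ℝ) < j := by linarith
      have hΔ : Real.log ((j : ℝ) + 1) - Real.log j ≤ 1 / j := by
        rw [← Real.log_div (by linarith) hjpos.ne']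
        have h := Real.log_le_sub_one_of_pos (show 0 < ((j : ℝ) + 1) / j by positivity)
        have : ((j : ℝ) + 1) / j - 1 = 1 / j := by field_simp; ring
        linarith
      have hΔ0 : 0 ≤ Real.log ((j : ℝ) + 1) - Real.log j := by
        rw [sub_nonneg]; exact Real.log_le_log hjpos (by linarith)
      calc (Real.log ((j : ℝ) + 1) - Real.log j) ^ 2 ≤ (1 / (j : ℝ)) ^ 2 := pow_le_pow_left₀ hΔ0 hΔ 2
        _ = ((j : ℝ) ^ 2)⁻¹ := by rw [one_div, inv_pow]
    refine (Finset.sum_le_sum h1).trans ?_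
    rcases Nat.lt_or_ge N 2 with hN2 | hN2
    · interval_cases N; simp
    · have hsplit : Finset.Ico 1 N = insert 1 (Finset.Ioc 1 (N - 1)) := by
        ext j; simp only [Finset.mem_Ico, Finset.mem_insert, Finset.mem_Ioc]; omega
      rw [hsplit, Finset.sum_insert (by simp)]
      have h2 := sum_Ioc_inv_sq_le_sub (α := ℝ) (k := 1) (n := N - 1) one_ne_zero (by omega)
      simp only [Nat.cast_one, inv_one, one_pow] at h2 ⊢
      have : ((N - 1 : ℕ) : ℝ)⁻¹ ≥ 0 := by positivity
      linarith
  have h1 : 0 ≤ (2 : ℝ) := by norm_num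
  rw [htel]
  linarith [div_le_div_of_nonneg_right hsq h1]

/-- **Lemma 14 (the main term `S₃`)**: there is an absolute `C` with
`(2/G²) ∑_{k≤N} μ²(k) log k/φ(k) ≥ 1 − C/log N` for all `N ≥ 3`; the source:
`S₃ = −1 + O(log log N/log N)`. [cite: Radziwill2012, Lemma 14] -/
theorem exists_main_term_ge : ∃ C : ℝ, 0 ≤ C ∧ ∀ N : ℕ, 3 ≤ N →
    1 - C / Real.log N ≤ 2 / Gs N ^ 2 * ∑ k ∈ Icc 1 N, ((μ k : ℝ)) ^ 2 * Real.log k / (k.totient : ℝ) := by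
  obtain ⟨C, hC0, hC⟩ := exists_abs_Gs_sub_log_le
  refine ⟨(1 + C) ^ 2 + 6 * C + 4, by positivity, fun N hN => ?_⟩
  have hN1 : 1 ≤ N := by omega
  have hN3 : (3 : ℝ) ≤ N := by exact_mod_cast hN
  set L := Real.log N with hL
  have hL1 : 1 ≤ L := by
    rw [hL, ← Real.log_exp 1]
    apply Real.log_le_log (Real.exp_pos 1)
    have := Real.exp_one_lt_d9; linarith
  set g : ℕ → ℝ := fun k => ((μ k : ℝ)) ^ 2 / (k.totient : ℝ) with hg
  have hGdef : ∀ n : ℕ, ∑ k ∈ Icc 1 n, g k = Gs n := fun n => rfl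
  have hg0 : ∀ k, 0 ≤ g k := fun k => by positivity
  -- Abel summation
  set S := ∑ k ∈ Icc 1 N, ((μ k : ℝ)) ^ 2 * Real.log k / (k.totient : ℝ) with hS
  have hS' : S = ∑ k ∈ Icc 1 N, g k * Real.log k := by
    refine Finset.sum_congr rfl fun k _ => ?_; simp only [hg]; ring
  have habel := sum_mul_log_eq_abel g N hN1
  rw [hGdef] at habel
  -- bound the correction sum
  have hcorr : ∑ j ∈ Finset.Ico 1 N, (Real.log ((j : ℝ) + 1) - Real.log j) * ∑ k ∈ Icc 1 j, g k ≤
      L ^ 2 / 2 + 1 + C * L := by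
    have h1 : ∀ j ∈ Finset.Ico 1 N, (Real.log ((j : ℝ) + 1) - Real.log j) * ∑ k ∈ Icc 1 j, g k ≤
        (Real.log ((j : ℝ) + 1) - Real.log j) * Real.log ((j : ℝ) + 1) +
          C * (Real.log ((j : ℝ) + 1) - Real.log j) := by
      intro j hj
      have hj1 : 1 ≤ j := (Finset.mem_Ico.1 hj).1
      have hjpos : (0 : ℝ) < j := by exact_mod_cast hj1
      have hΔ0 : 0 ≤ Real.log ((j : ℝ) + 1) - Real.log j := by
        rw [sub_nonneg]; exact Real.log_le_log hjpos (by linarith)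
      have hGj : ∑ k ∈ Icc 1 j, g k ≤ Real.log ((j : ℝ) + 1) + C := by
        rw [hGdef]; have := (abs_le.1 (hC j hj1)).2; linarith
      nlinarith
    refine (Finset.sum_le_sum h1).trans ?_
    rw [Finset.sum_add_distrib, ← Finset.mul_sum]
    have h2 := sum_delta_mul_log_le N hN1
    have h3 : ∑ j ∈ Finset.Ico 1 N, (Real.log ((j : ℝ) + 1) - Real.log j) = L := by
      have h := Finset.sum_Ico_sub (fun j => Real.log (j : ℝ)) hN1
      simp only [Nat.cast_add, Nat.cast_one, Real.log_one, sub_zero] at h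
      rw [hL]; exact h
    rw [h3]
    nlinarith
  -- lower bound for `S`
  have hGN := Gs_bounds (fun n hn => hC n hn) hN1
  have hSlo : L ^ 2 / 2 - 2 * C * L - 1 ≤ S := by
    rw [hS', habel]
    have : (L - C) * L ≤ Gs N * Real.log N := by
      rw [← hL]; nlinarith [hGN.1]
    linarith
  have hS0 : 0 ≤ S := Finset.sum_nonneg fun k hk => by
    have hk1 : (1 : ℝ) ≤ k := by exact_mod_cast (mem_Icc.1 hk).1
    have := Real.log_nonneg hk1
    positivity
  have hG1 := one_le_Gs hN1
  have hGup : Gs N ≤ L + 1 + C := hGN.2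
  -- conclude
  set U := L + 1 + C with hU
  have hUpos : 0 < U := by linarith
  have hGU : Gs N ^ 2 ≤ U ^ 2 := pow_le_pow_left₀ (by linarith) hGup 2
  by_cases hcase : 0 ≤ L ^ 2 / 2 - 2 * C * L - 1
  · -- main case
    have h1 : 2 / U ^ 2 * (L ^ 2 / 2 - 2 * C * L - 1) ≤ 2 / Gs N ^ 2 * S := by
      calc 2 / U ^ 2 * (L ^ 2 / 2 - 2 * C * L - 1) ≤ 2 / Gs N ^ 2 * (L ^ 2 / 2 - 2 * C * L - 1) := by
            apply mul_le_mul_of_nonneg_right _ hcase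
            apply div_le_div_of_nonneg_left (by norm_num) (by positivity) hGU
        _ ≤ 2 / Gs N ^ 2 * S := mul_le_mul_of_nonneg_left hSlo (by positivity)
    refine le_trans ?_ h1
    -- `1 − C'/L ≤ (L² − 4CL − 2)/U²`
    rw [show 2 / U ^ 2 * (L ^ 2 / 2 - 2 * C * L - 1) = 1 - (U ^ 2 - L ^ 2 + 4 * C * L + 2) / U ^ 2 by
      field_simp; ring]
    have hnum : 0 ≤ U ^ 2 - L ^ 2 + 4 * C * L + 2 := by rw [hU]; nlinarith
    have h2 : (U ^ 2 - L ^ 2 + 4 * C * L + 2) / U ^ 2 ≤ (U ^ 2 - L ^ 2 + 4 * C * L + 2) / L ^ 2 :=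
      div_le_div_of_nonneg_left hnum (by positivity) (pow_le_pow_left₀ (by linarith) (by rw [hU]; linarith) 2)
    have h3 : (U ^ 2 - L ^ 2 + 4 * C * L + 2) / L ^ 2 ≤ ((1 + C) ^ 2 + 6 * C + 4) / L := by
      rw [div_le_div_iff₀ (by positivity) (by positivity)]
      have : U ^ 2 - L ^ 2 + 4 * C * L + 2 = (2 * (1 + C) + 4 * C) * L + ((1 + C) ^ 2 + 2) := by
        rw [hU]; ring
      rw [this]
      nlinarith [mul_nonneg (by positivity : (0:ℝ) ≤ (1 + C) ^ 2 + 2) (by linarith : (0:ℝ) ≤ L - 1),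
        sq_nonneg L, mul_nonneg (by linarith : (0:ℝ) ≤ L) (by linarith : (0:ℝ) ≤ L - 1)]
    linarith
  · -- degenerate case: `L` is bounded, the claimed lower bound is `≤ 0`
    rw [not_le] at hcase
    have hLbd : L < 4 * C + 2 := by nlinarith
    have h0 : 0 ≤ 2 / Gs N ^ 2 * S := by positivity
    have : 1 - ((1 + C) ^ 2 + 6 * C + 4) / L ≤ 0 := by
      rw [sub_nonpos, le_div_iff₀ (by linarith)]
      nlinarith
    linarith

end PropB

end Literature.Barriers.RiemannHypothesis
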